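import Literature.NumberTheory.LFunctions.DobnerSelbergClassConvexityProofs
import Mathlib.Analysis.Fourier.Inversion
import HarnessLib

/-!
# Dobner, proof of Thm. 1: `H_0(z) = ξ^F((1+iz)/2)` by Fourier inversion — in HYPOTHESIS FORM

RH-FREE literature PROOFS (no definitions, no named facts). Trunk T-ANT
(`Literature/NumberTheory/LFunctions`); the Fourier-inversion half (c) of node **T1-STRIP** of the
plan of record for the discharge of `Literature.NumberTheory.LFunctions.dobner_theorem1` (rt-lead
ruling (32), rt/STATUS 2026-08-26), written — pipeline style, ruling (27) — with the two analytic
inputs of node T1-ADM (`DobnerSelbergClassKernelProofs.lean`: `Φ_F` integrable, `H_0` entire) as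
explicit HYPOTHESES, so that this module couples to no fresh olean; the hypothesis-free forms and
the frozen deliverable `ExtendedSelbergDatum.exists_rootsInStrip_Ht_zero` are the three-line assembly
of `DobnerSelbergClassStripProofs.lean`.

> A. Dobner, *A proof of Newman's conjecture for the extended Selberg class*, Acta Arith. 201
> (2021) 29–62 = arXiv:2005.05142, §2 pp. 5–6: «`Φ_F(u) = (1/2π) ∫_ℝ ξ^F((1+ix)/2) e^{−ixu} dx`
> … `H_t(z) = ∫_ℝ e^{tu²} Φ_F(u) e^{izu} du` … the functions `ξ^F_t` are simply the un-rotated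
> versions of `H_t`; in particular `H_0(z) = ξ^F((1+iz)/2)`» (Fourier inversion; both sides entire).

## Main results (`D : ExtendedSelbergDatum`, `k = D.numGamma ≥ 1`)

* `ExtendedSelbergDatum.fourier_xi_critical_line_eq` — the Mathlib Fourier transform of
  `x ↦ ξ^F((1+ix)/2)` is `w ↦ 2π · Φ_F(2πw)` (normalisations: Mathlib's `𝓕 f(w) = ∫ f(v)e^{−2πivw}dv`
  against Dobner's `e^{−ixu}/2π`).
* `ExtendedSelbergDatum.Ht_zero_ofReal_of` — assuming `Φ_F ∈ L¹`: `H_0(x) = ξ^F((1+ix)/2)` for real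
  `x` (Mathlib's `MeasureTheory.Integrable.fourierInv_fourier_eq`, with `x ↦ ξ^F((1+ix)/2)`
  continuous and integrable — `DobnerSelbergClassConvexityProofs.lean`).
* `ExtendedSelbergDatum.Ht_zero_eq_entire_of` — assuming moreover `H_0` entire: for EVERY entire
  `Ξ` agreeing with `ξ^F` on `{Re s > 0} ∖ {1}` (the tree's `exists_entire_xi` witnesses),
  `H_0(z) = Ξ((1+iz)/2)` on all of `ℂ` (identity theorem) — the `hH0` input shape of
  `ExtendedSelbergDatum.exists_rootsInStrip_Ht_zero_of` (node T1-d).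

LABEL: RH-FREE CONTENT, hypothesis form (0 facts). bears_on: N-C/N-P (COLUMN 3 DBN).
WHAT THIS IS NOT: a Fourier-inversion identity inside the re-proof of an RH-free theorem (the
existence of `Λ_F` for `F ∈ 𝒮♯`); nothing here bears on the truth of RH.
-/

noncomputable section

open Complex Filter Set Topology MeasureTheory
open scoped FourierTransform RealInnerProductSpace ComplexConjugate

namespace Literature.NumberTheory.LFunctions

namespace ExtendedSelbergDatum

variable (D : ExtendedSelbergDatum)

/-! ## The Fourier transform of `ξ^F` on the critical line is `2π Φ_F(2π ·)` -/

/-- Normalisations: `𝓕[x ↦ ξ^F((1+ix)/2)](w) = ∫ ξ^F((1+iv)/2) e^{−2πivw} dv = 2π · Φ_F(2πw)`.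
[cite: Dobner2021, §2 p. 5 (definition of Φ_F)] -/
theorem fourier_xi_critical_line_eq (w : ℝ) :
    𝓕 (fun x : ℝ ↦ D.xi ((1 + I * x) / 2)) w = (2 * Real.pi : ℂ) * D.Phi (2 * Real.pi * w) := by
  rw [Real.fourier_eq', Phi, ← mul_assoc,
    show (2 * Real.pi : ℂ) * (1 / (2 * Real.pi) : ℂ) = 1 by
      field_simp, one_mul]
  refine integral_congr_ae (ae_of_all _ fun v ↦ ?_)
  beta_reduce
  rw [smul_eq_mul, mul_comm, Real.inner_apply]
  congr 1
  push_cast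
  ring_nf

/-! ## `H_0(x) = ξ^F((1+ix)/2)` for real `x`, by Fourier inversion -/

/-- At `t = 0` the kernel of `H_t` is `Φ_F` itself: `H_0(z) = ∫ Φ_F(u) e^{izu} du`.
[cite: Dobner2021, §2 pp. 5–6 (definition of H_t)] -/
theorem Ht_zero_eq_integral (z : ℂ) :
    D.Ht 0 z = ∫ u : ℝ, D.Phi u * Complex.exp (I * z * u) := by
  rw [Ht, Literature.Analysis.Complex.trigIntegral]
  refine integral_congr_ae (ae_of_all _ fun u ↦ ?_)
  simp

/-- **`H_0 = ξ^F` on the critical line** (p. 6, «the un-rotated versions of `H_t`»), assuming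
`Φ_F ∈ L¹(ℝ)`: for real `x`, `H_0(x) = ξ^F((1+ix)/2)`. Proof: `x ↦ ξ^F((1+ix)/2)` is continuous and
integrable, its Fourier transform `2πΦ_F(2π·)` is integrable by hypothesis, and
`H_0(x) = ∫ Φ_F(u)e^{ixu}du = 𝓕⁻(𝓕 ξ^F((1+i·)/2))(x)` after `u = 2πv` (Mathlib's Fourier inversion
theorem). [cite: Dobner2021, §2 pp. 5–6] -/
theorem Ht_zero_ofReal_of (hk : 0 < D.numGamma) (hΦ : Integrable D.Phi) (x : ℝ) :
    D.Ht 0 x = D.xi ((1 + I * x) / 2) := by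
  set f : ℝ → ℂ := fun x ↦ D.xi ((1 + I * x) / 2) with hf
  have hfi : Integrable f := D.integrable_xi_critical_line hk
  have hfc : Continuous f := D.continuous_xi_critical_line
  have h2pi : (0 : ℝ) < 2 * Real.pi := by positivity
  have hFf_eq : 𝓕 f = fun w : ℝ ↦ (2 * Real.pi : ℂ) * D.Phi (2 * Real.pi * w) :=
    funext (D.fourier_xi_critical_line_eq)
  have hFfi : Integrable (𝓕 f) := by
    rw [hFf_eq]
    exact (hΦ.comp_mul_left' h2pi.ne').const_mul _
  have hinv : 𝓕⁻ (𝓕 f) x = f x := hfi.fourierInv_fourier_eq hFfi hfc.continuousAt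
  rw [show D.xi ((1 + I * x) / 2) = f x from rfl, ← hinv, Real.fourierInv_eq', D.Ht_zero_eq_integral]
  -- substitution `u = 2πv` in `∫ Φ_F(u) e^{ixu} du`
  set g : ℝ → ℂ := fun u ↦ D.Phi u * Complex.exp (I * (x : ℂ) * u) with hg
  have hsub : ∫ v : ℝ, g (2 * Real.pi * v) = |(2 * Real.pi)⁻¹| • ∫ u : ℝ, g u :=
    Measure.integral_comp_mul_left g (2 * Real.pi)
  have hB : ∫ u : ℝ, g u = ((2 * Real.pi : ℝ) : ℂ) * ∫ v : ℝ, g (2 * Real.pi * v) := by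
    rw [hsub, abs_of_pos (inv_pos.2 h2pi), Complex.real_smul, ← mul_assoc, ← Complex.ofReal_mul,
      mul_inv_cancel₀ h2pi.ne', Complex.ofReal_one, one_mul]
  rw [show (∫ u : ℝ, D.Phi u * Complex.exp (I * (x : ℂ) * u)) = ∫ u : ℝ, g u from rfl, hB,
    ← integral_const_mul]
  refine integral_congr_ae (ae_of_all _ fun v ↦ ?_)
  beta_reduce
  rw [smul_eq_mul, hFf_eq, hg, Real.inner_apply]
  beta_reduce
  have e : Complex.exp (I * (x : ℂ) * ((2 * Real.pi * v : ℝ) : ℂ)) =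
      Complex.exp (((2 * Real.pi * (v * x) : ℝ) : ℂ) * I) := by
    congr 1; push_cast; ring
  rw [e]
  push_cast
  ring

/-! ## `H_0(z) = Ξ((1+iz)/2)` on `ℂ` for every entire model `Ξ` of `ξ^F` -/

/-- A sequence of non-zero reals tending to `0` inside `𝓝[≠] 0` in `ℂ`. [folklore] -/
private theorem tendsto_inv_nat_succ_nhdsWithin :
    Tendsto (fun k : ℕ ↦ (((1 / ((k : ℝ) + 1) : ℝ)) : ℂ)) atTop (𝓝[≠] (0 : ℂ)) := by
  refine tendsto_nhdsWithin_iff.2 ⟨?_, Eventually.of_forall fun k ↦ ?_⟩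
  · have h0 : Tendsto (fun k : ℕ ↦ (((1 / ((k : ℝ) + 1) : ℝ)) : ℂ)) atTop (𝓝 ((0 : ℝ) : ℂ)) :=
      (Complex.continuous_ofReal.tendsto _).comp tendsto_one_div_add_atTop_nhds_zero_nat
    simpa using h0
  · rw [mem_compl_singleton_iff, Ne, Complex.ofReal_eq_zero]
    positivity

/-- **`H_0(z) = Ξ((1+iz)/2)` on all of `ℂ`** (p. 6), assuming `Φ_F ∈ L¹` and `H_0` entire: for every
entire `Ξ` agreeing with `ξ^F` on `{Re s > 0} ∖ {1}` (and satisfying the functional equation —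
not used), the two entire functions `H_0` and `z ↦ Ξ((1+iz)/2)` agree on `ℝ`
(`Ht_zero_ofReal_of`), hence everywhere (identity theorem). This is the `hH0` input of
`ExtendedSelbergDatum.exists_rootsInStrip_Ht_zero_of`. [cite: Dobner2021, §2 pp. 5–6] -/
theorem Ht_zero_eq_entire_of (hk : 0 < D.numGamma) (hΦ : Integrable D.Phi)
    (hH : Differentiable ℂ (D.Ht 0)) :
    ∀ Ξ : ℂ → ℂ, Differentiable ℂ Ξ → (∀ s : ℂ, 0 < s.re → s ≠ 1 → Ξ s = D.xi s) →
      (∀ s : ℂ, Ξ s = conj (Ξ (1 - conj s))) → ∀ z : ℂ, D.Ht 0 z = Ξ ((1 + I * z) / 2) := by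
  intro Ξ hΞd hΞxi _ z
  set G : ℂ → ℂ := fun w ↦ Ξ ((1 + I * w) / 2) with hG
  have hGd : Differentiable ℂ G := hΞd.comp (by fun_prop)
  -- agreement on `ℝ`
  have hreal : ∀ x : ℝ, D.Ht 0 x = G x := by
    intro x
    rw [D.Ht_zero_ofReal_of hk hΦ x, hG]
    refine (hΞxi _ ?_ ?_).symm
    · simp
    · intro h
      have := congrArg Complex.re h
      simp at this
  -- identity theorem at `0`
  have hfreq : ∃ᶠ w in 𝓝[≠] (0 : ℂ), D.Ht 0 w = G w :=
    tendsto_inv_nat_succ_nhdsWithin.frequently (Eventually.of_forall fun k ↦ hreal _).frequently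
  have hEq := (hH.differentiableOn.analyticOnNhd isOpen_univ).eqOn_of_preconnected_of_frequently_eq
    (hGd.differentiableOn.analyticOnNhd isOpen_univ) isPreconnected_univ (mem_univ _) hfreq
  exact hEq (mem_univ z)

end ExtendedSelbergDatum

end Literature.NumberTheory.LFunctions

end
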